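import Literature.NumberTheory.CubicFields.CubicFieldDiscriminant7255
import HarnessLib

/-!
# The cubic field of discriminant `−7255`, II: the primes above `2`, `3`, `5` are principal — `2 = 𝔭_a𝔭_b𝔭_c` (Dedekind's splitting, three prime elements of norm `±2`),
# `3 = 𝔭₁𝔭₂` (degrees `1`, `2`), `5` ramified, all with explicit generators on `1, θ, δ`

Sequel of `CubicFieldDiscriminant7255.lean` (att-p4 g46, cell `bsd-f1-sign2`).  THEOREMS ONLY.  Dedekind–Kummer through `θ` (`p ∤ 2 ⊇ [𝓞_F : ℤ[θ]]`) for `3`, `5`;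
the dyadic primes by the norm form.  [cite: Marcus2018, Ch. 3, Thm. 27 and Exercise 21] [cite: LMFDB, number field 3.1.7255.1]
-/

noncomputable section

open Polynomial NumberField NumberField.InfinitePlace Ideal Module Real
open Literature.NumberTheory.NumberFields
open Literature.NumberTheory.NumberFields.MonicCubic

namespace Literature.NumberTheory.CubicFields.CubicDisc7255

section NumberField

variable {F : Type*} [Field F] [NumberField F] {α : F}

/-! ## §3 The primes of norm `≤ 24` are principal: `p ≤ 5` -/

/-- `N(-362 - 90 * θ - 33 * δ) = -2` (norm form on `1, α, α²`; `δ = (α ^ 2 + α) / 2`). [cite: Marcus2018, Ch. 2, Thm. 4 and Exercise 13] -/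
theorem natAbs_norm_piA (h3 : finrank ℚ F = 3) (hα : aeval α (poly 6 19 (-10)) = 0) :
    (Algebra.norm ℤ (-362 - 90 * thetaInt hα - 33 * thetaInt (delta_root hα) : 𝓞 F)).natAbs = 2 := by
  have h : ((Algebra.norm ℤ (-362 - 90 * thetaInt hα - 33 * thetaInt (delta_root hα) : 𝓞 F) : ℤ) : ℚ) = Algebra.norm ℚ (algebraMap (𝓞 F) F (-362 - 90 * thetaInt hα - 33 * thetaInt (delta_root hα))) :=
    Algebra.coe_norm_int _
  have hx : algebraMap (𝓞 F) F (-362 - 90 * thetaInt hα - 33 * thetaInt (delta_root hα)) = ((-362 : ℚ) : F) + ((-213/2 : ℚ) : F) * α + ((-33/2 : ℚ) : F) * α ^ 2 := by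
    simp only [map_mul, map_sub, map_neg, map_ofNat, MonicCubic.thetaInt, RingOfIntegers.map_mk]
    push_cast; ring
  rw [hx, norm_lin irreducible_polyQ hα h3] at h
  have hn : normForm 6 19 (-10) (-362) (-213/2) (-33/2) = ((-2 : ℤ) : ℚ) := by norm_num [normForm]
  rw [hn] at h
  have h' : Algebra.norm ℤ (-362 - 90 * thetaInt hα - 33 * thetaInt (delta_root hα) : 𝓞 F) = -2 := by exact_mod_cast h
  rw [h']; rfl

/-- `-362 - 90 * θ - 33 * δ` is a prime element of `𝓞_F` (norm `-2`). [cite: Marcus2018, Ch. 3, Thm. 27] -/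
theorem prime_piA (h3 : finrank ℚ F = 3) (hα : aeval α (poly 6 19 (-10)) = 0) : Prime (-362 - 90 * thetaInt hα - 33 * thetaInt (delta_root hα) : 𝓞 F) :=
  prime_of_natAbs_norm_prime (by rw [natAbs_norm_piA h3 hα]; norm_num)

/-- `N(208 + 1241 * θ - 2332 * δ) = -2` (norm form on `1, α, α²`; `δ = (α ^ 2 + α) / 2`). [cite: Marcus2018, Ch. 2, Thm. 4 and Exercise 13] -/
theorem natAbs_norm_piB (h3 : finrank ℚ F = 3) (hα : aeval α (poly 6 19 (-10)) = 0) :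
    (Algebra.norm ℤ (208 + 1241 * thetaInt hα - 2332 * thetaInt (delta_root hα) : 𝓞 F)).natAbs = 2 := by
  have h : ((Algebra.norm ℤ (208 + 1241 * thetaInt hα - 2332 * thetaInt (delta_root hα) : 𝓞 F) : ℤ) : ℚ) = Algebra.norm ℚ (algebraMap (𝓞 F) F (208 + 1241 * thetaInt hα - 2332 * thetaInt (delta_root hα))) :=
    Algebra.coe_norm_int _
  have hx : algebraMap (𝓞 F) F (208 + 1241 * thetaInt hα - 2332 * thetaInt (delta_root hα)) = ((208 : ℚ) : F) + ((75 : ℚ) : F) * α + ((-1166 : ℚ) : F) * α ^ 2 := by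
    simp only [map_mul, map_add, map_sub, map_ofNat, MonicCubic.thetaInt, RingOfIntegers.map_mk]
    push_cast; ring
  rw [hx, norm_lin irreducible_polyQ hα h3] at h
  have hn : normForm 6 19 (-10) (208) (75) (-1166) = ((-2 : ℤ) : ℚ) := by norm_num [normForm]
  rw [hn] at h
  have h' : Algebra.norm ℤ (208 + 1241 * thetaInt hα - 2332 * thetaInt (delta_root hα) : 𝓞 F) = -2 := by exact_mod_cast h
  rw [h']; rfl

/-- `208 + 1241 * θ - 2332 * δ` is a prime element of `𝓞_F` (norm `-2`). [cite: Marcus2018, Ch. 3, Thm. 27] -/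
theorem prime_piB (h3 : finrank ℚ F = 3) (hα : aeval α (poly 6 19 (-10)) = 0) : Prime (208 + 1241 * thetaInt hα - 2332 * thetaInt (delta_root hα) : 𝓞 F) :=
  prime_of_natAbs_norm_prime (by rw [natAbs_norm_piB h3 hα]; norm_num)

/-- `N(-1410168 - 350627 * θ - 128535 * δ) = -2` (norm form on `1, α, α²`; `δ = (α ^ 2 + α) / 2`). [cite: Marcus2018, Ch. 2, Thm. 4 and Exercise 13] -/
theorem natAbs_norm_piC (h3 : finrank ℚ F = 3) (hα : aeval α (poly 6 19 (-10)) = 0) :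
    (Algebra.norm ℤ (-1410168 - 350627 * thetaInt hα - 128535 * thetaInt (delta_root hα) : 𝓞 F)).natAbs = 2 := by
  have h : ((Algebra.norm ℤ (-1410168 - 350627 * thetaInt hα - 128535 * thetaInt (delta_root hα) : 𝓞 F) : ℤ) : ℚ) = Algebra.norm ℚ (algebraMap (𝓞 F) F (-1410168 - 350627 * thetaInt hα - 128535 * thetaInt (delta_root hα))) :=
    Algebra.coe_norm_int _
  have hx : algebraMap (𝓞 F) F (-1410168 - 350627 * thetaInt hα - 128535 * thetaInt (delta_root hα)) = ((-1410168 : ℚ) : F) + ((-829789/2 : ℚ) : F) * α + ((-128535/2 : ℚ) : F) * α ^ 2 := by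
    simp only [map_mul, map_sub, map_neg, map_ofNat, MonicCubic.thetaInt, RingOfIntegers.map_mk]
    push_cast; ring
  rw [hx, norm_lin irreducible_polyQ hα h3] at h
  have hn : normForm 6 19 (-10) (-1410168) (-829789/2) (-128535/2) = ((-2 : ℤ) : ℚ) := by norm_num [normForm]
  rw [hn] at h
  have h' : Algebra.norm ℤ (-1410168 - 350627 * thetaInt hα - 128535 * thetaInt (delta_root hα) : 𝓞 F) = -2 := by exact_mod_cast h
  rw [h']; rfl

/-- `-1410168 - 350627 * θ - 128535 * δ` is a prime element of `𝓞_F` (norm `-2`). [cite: Marcus2018, Ch. 3, Thm. 27] -/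
theorem prime_piC (h3 : finrank ℚ F = 3) (hα : aeval α (poly 6 19 (-10)) = 0) : Prime (-1410168 - 350627 * thetaInt hα - 128535 * thetaInt (delta_root hα) : 𝓞 F) :=
  prime_of_natAbs_norm_prime (by rw [natAbs_norm_piC h3 hα]; norm_num)

/-- **`2` splits completely**: `(-362 - 90 * θ - 33 * δ)·(208 + 1241 * θ - 2332 * δ)·(-1410168 - 350627 * θ - 128535 * δ) = (-1)·2` (the cofactor is a unit). [cite: Marcus2018, Ch. 3, Thm. 27 and Exercise 21 (Dedekind)] -/
theorem prod_dyadic_eq (hα : aeval α (poly 6 19 (-10)) = 0) :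
    (-362 - 90 * thetaInt hα - 33 * thetaInt (delta_root hα) : 𝓞 F) * (208 + 1241 * thetaInt hα - 2332 * thetaInt (delta_root hα)) * (-1410168 - 350627 * thetaInt hα - 128535 * thetaInt (delta_root hα)) = (-1) * (((2 : ℕ) : ℤ) : 𝓞 F) := by
  rw [RingOfIntegers.ext_iff]
  simp only [map_mul, map_add, map_sub, map_neg, map_ofNat, map_one, map_intCast, MonicCubic.thetaInt, RingOfIntegers.map_mk]
  push_cast
  linear_combination (((-10618000973 : F)) + ((-60501203499 : F) / 2) * α + ((-33858574167 : F) / 4) * α ^ 2 + ((-2472884865 : F) / 2) * α ^ 3) * cubic_eq hα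

/-- **Every prime of `𝓞_F` above `2` is principal**: `2` is the product of the three prime elements above (up to a unit), so a prime `P ∋ 2` is one of
the three principal primes `(π)`. [cite: Marcus2018, Ch. 3, Thm. 27 and Exercise 21] [cite: LMFDB, number field 3.1.7255.1 (class number 1)] -/
theorem isPrincipal_of_mem_primesOver_2 (h3 : finrank ℚ F = 3) (hα : aeval α (poly 6 19 (-10)) = 0) {P : Ideal (𝓞 F)}
    (hP : P ∈ primesOver (span {((2 : ℕ) : ℤ)}) (𝓞 F)) : Submodule.IsPrincipal P := by
  haveI := hP.1
  have h2 : (((2 : ℕ) : ℤ) : 𝓞 F) ∈ P := by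
    have hu : ((2 : ℕ) : ℤ) ∈ P.under ℤ := by
      rw [← hP.2.over]; exact Ideal.mem_span_singleton_self _
    exact hu
  have hmem : (-362 - 90 * thetaInt hα - 33 * thetaInt (delta_root hα) : 𝓞 F) * (208 + 1241 * thetaInt hα - 2332 * thetaInt (delta_root hα)) * (-1410168 - 350627 * thetaInt hα - 128535 * thetaInt (delta_root hα)) ∈ P := by
    rw [prod_dyadic_eq hα]; exact P.mul_mem_left _ h2
  rcases eq_span_singleton_of_prod_mem hP.1 (prime_piA h3 hα) (prime_piB h3 hα) (prime_piC h3 hα) hmem with h | h | h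
  · exact ⟨⟨_, by rw [h, Ideal.submodule_span_eq]⟩⟩
  · exact ⟨⟨_, by rw [h, Ideal.submodule_span_eq]⟩⟩
  · exact ⟨⟨_, by rw [h, Ideal.submodule_span_eq]⟩⟩

/-- `(3, θ + 1) = (-23717 + 86224 * θ - 46964 * δ)`, an element of norm `3` (identities checked in `F`, `δ = (α ^ 2 + α) / 2`).
[cite: Marcus2018, Ch. 3, Thm. 27] -/
theorem span_3_lin1_eq (hα : aeval α (poly 6 19 (-10)) = 0) :
    span {(3 : 𝓞 F), thetaInt hα + 1} = span {-23717 + 86224 * thetaInt hα - 46964 * thetaInt (delta_root hα)} := by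
  apply le_antisymm
  · rw [span_le]
    rintro x hx
    rcases hx with rfl | hx
    · exact mem_span_singleton'.mpr ⟨498002943961 + 123824450768 * thetaInt hα + 45392327980 * thetaInt (delta_root hα), by
          rw [RingOfIntegers.ext_iff]
          simp only [map_mul, map_add, map_sub, map_neg, map_ofNat, MonicCubic.thetaInt, RingOfIntegers.map_mk]
          linear_combination (((1181113582192304 : F)) + ((-532951322813180 : F)) * α) * cubic_eq hα⟩
    · rw [Set.mem_singleton_iff.mp hx]
      exact mem_span_singleton'.mpr ⟨241654861287 + 60085549367 * thetaInt hα + 22026529872 * thetaInt (delta_root hα), by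
          rw [RingOfIntegers.ext_iff]
          simp only [map_mul, map_add, map_sub, map_neg, map_ofNat, map_one, MonicCubic.thetaInt, RingOfIntegers.map_mk]
          linear_combination (((573132834514378 : F)) + ((-258613487227152 : F)) * α) * cubic_eq hα⟩
  · rw [span_singleton_le_iff_mem, mem_span_pair]
    exact ⟨36647 * thetaInt hα - 46964 * thetaInt (delta_root hα), -23717 + 46964 * thetaInt hα, by
        rw [RingOfIntegers.ext_iff]
        simp only [map_mul, map_add, map_sub, map_neg, map_ofNat, map_one, MonicCubic.thetaInt, RingOfIntegers.map_mk]
        linear_combination (0 : F) * cubic_eq hα⟩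

/-- `(3, θ ^ 2 + 2 * θ + 2) = (498002943961 + 123824450768 * θ + 45392327980 * δ)`, an element of norm `9` (identities checked in `F`, `δ = (α ^ 2 + α) / 2`).
[cite: Marcus2018, Ch. 3, Thm. 27] -/
theorem span_3_quad_eq (hα : aeval α (poly 6 19 (-10)) = 0) :
    span {(3 : 𝓞 F), thetaInt hα ^ 2 + 2 * thetaInt hα + 2} = span {498002943961 + 123824450768 * thetaInt hα + 45392327980 * thetaInt (delta_root hα)} := by
  apply le_antisymm
  · rw [span_le]
    rintro x hx
    rcases hx with rfl | hx
    · exact mem_span_singleton'.mpr ⟨-23717 + 86224 * thetaInt hα - 46964 * thetaInt (delta_root hα), by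
          rw [RingOfIntegers.ext_iff]
          simp only [map_mul, map_add, map_sub, map_neg, map_ofNat, MonicCubic.thetaInt, RingOfIntegers.map_mk]
          linear_combination (((1181113582192304 : F)) + ((-532951322813180 : F)) * α) * cubic_eq hα⟩
    · rw [Set.mem_singleton_iff.mp hx]
      exact mem_span_singleton'.mpr ⟨506422 - 898147 * thetaInt hα - 292706 * thetaInt (delta_root hα), by
          rw [RingOfIntegers.ext_iff]
          simp only [map_mul, map_add, map_sub, map_pow, map_ofNat, MonicCubic.thetaInt, RingOfIntegers.map_mk]
          linear_combination (((-25219964688661754 : F)) + ((-3321651688428470 : F)) * α) * cubic_eq hα⟩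
  · rw [span_singleton_le_iff_mem, mem_span_pair]
    exact ⟨498002943961 + 207275798243 * thetaInt hα + 347132738634 * thetaInt (delta_root hα), -498002943961, by
        rw [RingOfIntegers.ext_iff]
        simp only [map_mul, map_add, map_neg, map_pow, map_ofNat, MonicCubic.thetaInt, RingOfIntegers.map_mk]
        linear_combination (0 : F) * cubic_eq hα⟩

/-- **Every prime of `𝓞_F` above `3` is principal** (Dedekind–Kummer through `θ`, `3 ∤ exponent`, with `polyMod_3` and the generators above).
[cite: Marcus2018, Ch. 3, Thm. 27] [cite: LMFDB, number field 3.1.7255.1 (class number 1)] -/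
theorem isPrincipal_of_mem_primesOver_3 (h3 : finrank ℚ F = 3) (hα : aeval α (poly 6 19 (-10)) = 0) {P : Ideal (𝓞 F)}
    (hP : P ∈ primesOver (span {((3 : ℕ) : ℤ)}) (𝓞 F)) : Submodule.IsPrincipal P := by
  haveI : Fact (Nat.Prime 3) := ⟨by norm_num⟩
  obtain ⟨Qb, hirr, hmon, hdvd, -, hspan⟩ :=
    exists_factor_of_mem_primesOver' irreducible_polyQ hα (by norm_num : Nat.Prime 3)
      (not_dvd_exponent h3 hα (by norm_num) (by norm_num)) hP
  rw [polyMod_3] at hdvd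
  rcases hirr.prime.dvd_or_dvd hdvd with h | h
  · have hirr1 : Irreducible (X + 1 : (ZMod 3)[X]) := by
      rw [show (X + 1 : (ZMod 3)[X]) = X - C (-1) by rw [map_neg, map_one, sub_neg_eq_add]]
      exact irreducible_X_sub_C _
    have hQb : Qb = X + 1 := eq_of_monic_of_associated hmon (by monicity!) (hirr.associated_of_dvd hirr1 h)
    have hPeq := hspan (X + 1) (by rw [hQb]; simp)
    rw [show aeval (thetaInt hα) (X + 1 : ℤ[X]) = thetaInt hα + 1 by
        simp only [map_add, aeval_X, map_one], Nat.cast_ofNat, span_3_lin1_eq hα] at hPeq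
    exact ⟨⟨-23717 + 86224 * thetaInt hα - 46964 * thetaInt (delta_root hα), by rw [hPeq, Ideal.submodule_span_eq]⟩⟩
  · have hQb : Qb = X ^ 2 + 2 * X + 2 :=
      eq_of_monic_of_associated hmon (by monicity!) (hirr.associated_of_dvd CubicDisc2071.irreducible_quad_3 h)
    have hPeq := hspan (X ^ 2 + 2 * X + 2) (by rw [hQb]; simp)
    rw [show aeval (thetaInt hα) (X ^ 2 + 2 * X + 2 : ℤ[X]) = thetaInt hα ^ 2 + 2 * thetaInt hα + 2 by
        simp only [map_add, map_pow, aeval_X, map_mul, map_ofNat, map_ofNat], Nat.cast_ofNat, span_3_quad_eq hα] at hPeq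
    exact ⟨⟨498002943961 + 123824450768 * thetaInt hα + 45392327980 * thetaInt (delta_root hα), by rw [hPeq, Ideal.submodule_span_eq]⟩⟩

/-- `(5, θ) = (614355 - 1617352 * θ + 370016 * δ)`, an element of norm `-5` (identities checked in `F`, `δ = (α ^ 2 + α) / 2`).
[cite: Marcus2018, Ch. 3, Thm. 27] -/
theorem span_5_lin0_eq (hα : aeval α (poly 6 19 (-10)) = 0) :
    span {(5 : 𝓞 F), thetaInt hα} = span {614355 - 1617352 * thetaInt hα + 370016 * thetaInt (delta_root hα)} := by
  apply le_antisymm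
  · rw [span_le]
    rintro x hx
    rcases hx with rfl | hx
    · exact mem_span_singleton'.mpr ⟨-91679857859641 - 22795463728920 * thetaInt hα - 8356501156448 * thetaInt (delta_root hα), by
          rw [RingOfIntegers.ext_iff]
          simp only [map_mul, map_add, map_sub, map_neg, map_ofNat, MonicCubic.thetaInt, RingOfIntegers.map_mk]
          linear_combination (((5632397907535974656 : F)) + ((-773009782976065792 : F)) * α) * cubic_eq hα⟩
    · rw [Set.mem_singleton_iff.mp hx]
      exact mem_span_singleton'.mpr ⟨-8356501156448 - 2077777207117 * thetaInt hα - 761684335120 * thetaInt (delta_root hα), by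
          rw [RingOfIntegers.ext_iff]
          simp only [map_mul, map_add, map_sub, map_neg, map_ofNat, MonicCubic.thetaInt, RingOfIntegers.map_mk]
          linear_combination (((513385826796961104 : F)) + ((-70458847735940480 : F)) * α) * cubic_eq hα⟩
  · rw [span_singleton_le_iff_mem, mem_span_pair]
    exact ⟨122871 + 370016 * thetaInt (delta_root hα), -2357384 - 740032 * thetaInt hα, by
        rw [RingOfIntegers.ext_iff]
        simp only [map_mul, map_add, map_sub, map_neg, map_ofNat, MonicCubic.thetaInt, RingOfIntegers.map_mk]
        linear_combination (0 : F) * cubic_eq hα⟩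

/-- `(5, θ + 3) = (8953829 + 2226298 * θ + 816130 * δ)`, an element of norm `5` (identities checked in `F`, `δ = (α ^ 2 + α) / 2`).
[cite: Marcus2018, Ch. 3, Thm. 27] -/
theorem span_5_lin3_eq (hα : aeval α (poly 6 19 (-10)) = 0) :
    span {(5 : 𝓞 F), thetaInt hα + 3} = span {8953829 + 2226298 * thetaInt hα + 816130 * thetaInt (delta_root hα)} := by
  apply le_antisymm
  · rw [span_le]
    rintro x hx
    rcases hx with rfl | hx
    · exact mem_span_singleton'.mpr ⟨465 - 422 * thetaInt hα - 822 * thetaInt (delta_root hα), by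
          rw [RingOfIntegers.ext_iff]
          simp only [map_mul, map_add, map_sub, map_ofNat, MonicCubic.thetaInt, RingOfIntegers.map_mk]
          linear_combination (((-416353048 : F)) + ((-167714715 : F)) * α) * cubic_eq hα⟩
    · rw [Set.mem_singleton_iff.mp hx]
      exact mem_span_singleton'.mpr ⟨-543 + 1075 * thetaInt hα + 160 * thetaInt (delta_root hα), by
          rw [RingOfIntegers.ext_iff]
          simp only [map_mul, map_add, map_neg, map_ofNat, MonicCubic.thetaInt, RingOfIntegers.map_mk]
          linear_combination (((486192915 : F)) + ((32645200 : F)) * α) * cubic_eq hα⟩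
  · rw [span_singleton_le_iff_mem, mem_span_pair]
    exact ⟨-8953829 - 15681360 * thetaInt hα - 12381862 * thetaInt (delta_root hα), 17907658 + 31362720 * thetaInt hα, by
        rw [RingOfIntegers.ext_iff]
        simp only [map_mul, map_add, map_sub, map_neg, map_ofNat, MonicCubic.thetaInt, RingOfIntegers.map_mk]
        linear_combination (0 : F) * cubic_eq hα⟩

/-- **Every prime of `𝓞_F` above `5` is principal** (Dedekind–Kummer through `θ`, `5 ∤ exponent`, with `polyMod_5` and the generators above).
[cite: Marcus2018, Ch. 3, Thm. 27] [cite: LMFDB, number field 3.1.7255.1 (class number 1)] -/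
theorem isPrincipal_of_mem_primesOver_5 (h3 : finrank ℚ F = 3) (hα : aeval α (poly 6 19 (-10)) = 0) {P : Ideal (𝓞 F)}
    (hP : P ∈ primesOver (span {((5 : ℕ) : ℤ)}) (𝓞 F)) : Submodule.IsPrincipal P := by
  haveI : Fact (Nat.Prime 5) := ⟨by norm_num⟩
  obtain ⟨Qb, hirr, hmon, hdvd, -, hspan⟩ :=
    exists_factor_of_mem_primesOver' irreducible_polyQ hα (by norm_num : Nat.Prime 5)
      (not_dvd_exponent h3 hα (by norm_num) (by norm_num)) hP
  rw [polyMod_5] at hdvd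
  rcases hirr.prime.dvd_or_dvd hdvd with h12 | h
  · rcases hirr.prime.dvd_or_dvd h12 with h | h
    · have hQb : Qb = X := eq_of_monic_of_associated hmon monic_X (hirr.associated_of_dvd irreducible_X h)
      have hPeq := hspan X (by rw [hQb, Polynomial.map_X])
      rw [aeval_X, Nat.cast_ofNat, span_5_lin0_eq hα] at hPeq
      exact ⟨⟨614355 - 1617352 * thetaInt hα + 370016 * thetaInt (delta_root hα), by rw [hPeq, Ideal.submodule_span_eq]⟩⟩
    · have hirr1 : Irreducible (X + 3 : (ZMod 5)[X]) := by
        rw [show (X + 3 : (ZMod 5)[X]) = X - C (-3) by rw [map_neg, map_ofNat]; ring]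
        exact irreducible_X_sub_C _
      have hQb : Qb = X + 3 := eq_of_monic_of_associated hmon (by monicity!) (hirr.associated_of_dvd hirr1 h)
      have hPeq := hspan (X + C 3) (by rw [hQb]; simp [map_ofNat])
      rw [show aeval (thetaInt hα) (X + C 3 : ℤ[X]) = thetaInt hα + 3 by
          simp only [map_add, aeval_X, aeval_C, algebraMap_int_eq, Int.coe_castRingHom, Int.cast_ofNat], Nat.cast_ofNat, span_5_lin3_eq hα] at hPeq
      exact ⟨⟨8953829 + 2226298 * thetaInt hα + 816130 * thetaInt (delta_root hα), by rw [hPeq, Ideal.submodule_span_eq]⟩⟩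
  · have hirr1 : Irreducible (X + 3 : (ZMod 5)[X]) := by
      rw [show (X + 3 : (ZMod 5)[X]) = X - C (-3) by rw [map_neg, map_ofNat]; ring]
      exact irreducible_X_sub_C _
    have hQb : Qb = X + 3 := eq_of_monic_of_associated hmon (by monicity!) (hirr.associated_of_dvd hirr1 h)
    have hPeq := hspan (X + C 3) (by rw [hQb]; simp [map_ofNat])
    rw [show aeval (thetaInt hα) (X + C 3 : ℤ[X]) = thetaInt hα + 3 by
        simp only [map_add, aeval_X, aeval_C, algebraMap_int_eq, Int.coe_castRingHom, Int.cast_ofNat], Nat.cast_ofNat, span_5_lin3_eq hα] at hPeq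
    exact ⟨⟨8953829 + 2226298 * thetaInt hα + 816130 * thetaInt (delta_root hα), by rw [hPeq, Ideal.submodule_span_eq]⟩⟩

end NumberField

end Literature.NumberTheory.CubicFields.CubicDisc7255

end
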